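/-
Copyright (c) 2026 the pub-hodgecm-mathlib formalisation cell (harness21).  Prover seat hodgecm-mathlib-R90-C10-p01 (g3), SLAB R90-TF, section S1 «Ch. 10∕12 local»;
crux H413 = `stmt-HodgeConjecture-24833`; line «B_pos-inert» (U4Keys :182, Branch B at positive depth, lead R90-C10-p05 (g2), memo `DESIGN-Bpos-inert.md`
f70d293d60bf8a4b §4–§5), brick (B-6), dealt BY NAME by R90-C10-plan (g2) in ruling R-S1-16 (5) (2026-09-04T23:46:17Z).  KERNEL module: THEOREMS ONLY (no definition,
no named fact, no `sorry`, no instance, no notation).  2026-09-05.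
-/
import Summits.HodgeConjecture.HodgeConjecture.Theorems.K2E3BranchBDeterminantLettersToRoot        -- ★ Z3-d (K2E3-p32 (g0)): `eq_neg_inv_of_det_eq_zero` (the d0B letters ⟹ `Y = −1∕q`; ★ Z4 `K2E3BranchBDeterminantRoots` inside)
import Summits.HodgeConjecture.HodgeConjecture.Theorems.K2E3KeysThmTwoDepthZeroBranchBConversion   -- ★ Z5 (K2E3-p32 (g0)): `exists_eta_of_branchB_of_apply_uniformizer_eq_neg_inv_absNorm` (`Y = −1∕q` ⟹ `χ₁ = η·‖·‖^{1∕2}`, NO depth hypothesis)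
import HarnessLib

/-!
# R90-TF · S1 «Ch10-local» ∕ K2 E3 «U4Keys» :182, BRANCH B AT POSITIVE DEPTH (inert) — brick (B-6) `R90S1BposDeterminantClosedForm`:
# THE CASSELMAN-PAIR DETERMINANT AT ROCHE'S LEVEL `J_e` IN CLOSED FORM, `det M = q^{2−2n}·μ(N₀)²·det_{d0}(X)`, ITS ADMISSIBLE ROOT `X = −1∕q`, AND THE END ASSEMBLY
# `det M = 0 ⟹ χ₁ = η·‖·‖^{1∕2}` — HYPOTHESIS-FIRST over the four entry values and the two volumes as LETTERS
# [Keys1984 §3, §7 Thm (2); Casselman1980 §3; Roche1998 §3–§4; Rogawski1990 §12.2]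

Cell `pub/hodgecm-mathlib`, crux H413 = `stmt-HodgeConjecture-24833`, route of record `HCCMUnconditional` (no route verbs); R90-TF section S1 (base R90-C10), dealer
R90-C10-plan (g2), line lead R90-C10-p05 (g2) («=∕≠» on the HEAD), auditor R90-C10-audit1 (g2).  THEOREMS ONLY; lane `--supports stmt-HodgeConjecture-24833 --as helper`,
count-neutral.  NOT THE PAYER of :182 (the leaf (B-7) `R90S1KeysThmTwoPosDepthBranchBInertLeaf` assembles (B-0)…(B-6)).

THE POINT (memo §4).  In Branch B at an inert place `v` (residue cardinality `q = N𝔭_v`, `|2|_w = 1`) with `χ₁` of conductor `n ≥ 2`, the d0B programme runs at the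
two-depth level group `J_e`, `e = (⌊n∕2⌋, 0; ⌈n∕2⌉, 1)` (★ D174), and the `(J_e, θ)`-plane of `i(χ₁, 1)` carries the `2 × 2` matrix of the two intertwining functionals
`Λ_g φ = ∫_N φ(w₀ n g) dμ(n)` (`g ∈ {1, w₀}`) on the normalised type basis `(f₁, f_w)`.  Its four entries, in the letters `X = χ₁(ϖ̂)` (`|X| < 1`, contracting), a sign
`ε₀` (`= λ(δ)`, `ε₀² = 1`), a sign `c₂` (`c₂² = 1`), the Haar unit `V = μ(N₀) ≠ 0` and the depths `r + r′ = n`: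
`Λ_1 f₁ = G₁ = c₂·(ε₀·((q−1)∕q^{n+1})·V·X∕(1+X))` (memo (M11), (B-5′)), `Λ_{w₀} f_w = G₂ = −c₂·(ε₀·((q−1)∕q^{n+1})·V∕(1+X))` (memo (M22), (B-5)),
`Λ_1 f_w = vol(N ∩ J_e) = (q^{2r})⁻¹·V` (memo (M12)), `Λ_{w₀} f₁ = vol{n : w₀ n w₀ ∈ P·J_e} = (q^{2r′+1})⁻¹·V` (memo (M21)).  THIS FILE is the closing algebra, stated
HYPOTHESIS-FIRST over those six values as LETTERS (R-S1-16 (5): it waits for none of (B-1)(B-5)(B-5′)), by ONE RESCALING onto the depth-zero letters of ★ Z3-d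
`K2E3BranchBDeterminantLettersToRoot`: with `V′ := q^{1−n}·V` the big-cell entries are EXACTLY the d0B entries at `V′`, and the product of the two volumes is EXACTLY
`V′·(q⁻³V′)` — so `det M = V′²·det_{d0}(X) = q^{2−2n}·V²·(−(q−1)²q⁻⁴X∕(1+X)² − q⁻³)` («n = 1 recovers d0B on the nose») and ★ Z3-d ∕ ★ Z4 ∕ ★ Z5 apply VERBATIM.
Memo §7 (d) CHECK, answered: ★ FromDet §1 `exists_eta_of_det_eq_zero_of_pairEntries` and ★ Z3-d take `V` as a FREE complex letter (`V ≠ 0`); the literal `μ.real {m | m ∈ I}`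
appears only in the frame-bound §2 of ★ FromDet — hence no restatement of FromDet's algebra is needed, only the rescaling below.
* §1 **`volProduct_eq_of_twoDepth`** — `(q^{2r})⁻¹V · (q^{2r′+1})⁻¹V = (q^{2n+1})⁻¹·V²` for `r + r′ = n` (the only place the split `(r, r′)` enters).
* §2 **`det_letters_eq_posDepth`** — the CLOSED FORM `Λ_1 f₁·Λ_{w₀} f_w − Λ_1 f_w·Λ_{w₀} f₁ = (q^{1−n}V)²·(−(q−1)²(q⁴)⁻¹·X·((1+X)²)⁻¹ − (q³)⁻¹)` (★ Z3-d `det_letters_eq` at `V′`).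
* §3 **`eq_neg_inv_of_det_eq_zero_posDepth`** — `det M = 0`, `V ≠ 0`, `|X| < 1 < q` ⟹ **`X = −q⁻¹`** (★ Z3-d `eq_neg_inv_of_det_eq_zero` at `V′`; ★ Z4 inside).
* §4 **`exists_eta_of_det_eq_zero_of_pairEntries_posDepth`** (CM letters, frame-free — the positive-depth twin of ★ FromDet §1): `v` non-split and unramified in `L`,
  `χ₁` continuous with `χ₁(u·σu) = 1` on units of valuation one (Branch B), the four entries + `det M = 0` ⟹ **`∃ η`, `IsQuadraticCharExtension σ η ∧ Continuous η ∧
  χ₁ = η·halfModulusChar`** — DISJUNCT 2 of :182 (★ Z5, which carries NO depth hypothesis); and **`…_twoDepth`**, the same with the two volumes split as `(q^{2r})⁻¹V`,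
  `(q^{2r′+1})⁻¹V`, `r + r′ = n` (the shape (B-7) feeds after (B-1)∕(B-5)∕(B-5′)).
HONEST LABEL.  HC_CM is proved only modulo the 7 printed citations (2 remaining named inputs: hLiu418 = `stmt-HodgeConjecture-24832`, h413 = `stmt-HodgeConjecture-24833`) until
rung 0 closes; count-neutral — this file is algebra over LETTERS and does NOT pay :182 or A2′; no printed citation is discharged; REL ≠ ★ ≠ BUILT.

## References
* [Keys1984] D. Keys, *Principal series representations of special unitary groups over local fields*, Compositio Math. 51 (1984), §3, §7 Theorem (2) p. 126.
* [Casselman1980] W. Casselman, *The unramified principal series of p-adic groups I*, Compositio Math. 40 (1980), §3.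
* [Roche1998] A. Roche, *Types and Hecke algebras for principal series representations of split reductive p-adic groups*, Ann. Sci. ÉNS (4) 31 (1998), §3–§4.
* [Rogawski1990] J. Rogawski, *Automorphic Representations of Unitary Groups in Three Variables*, Ann. of Math. Stud. 123 (1990), §12.2 (1)–(2) p. 173.
-/

set_option autoImplicit false
-- the mandated namespace has the single-problem summit's repeated segment (`HodgeConjecture.HodgeConjecture`)
set_option linter.dupNamespace false

noncomputable section

open NumberField IsDedekindDomain
open Literature.NumberTheory Literature.NumberTheory.Automorphic Literature.NumberTheory.Automorphic.UnitaryGroup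
open Literature.NumberTheory.Rogawski1990

namespace Summit.HodgeConjecture.HodgeConjecture.R90.S1.BposDeterminantClosedForm

open Summit.HodgeConjecture.HodgeConjecture.Cruxes.H413

/-! ## §1 The two volumes: only their product matters -/

/-- **`vol(N ∩ J_e) · vol{n : w₀ n w₀ ∈ P·J_e} = (q^{2n+1})⁻¹·V²`** — with `Λ_1 f_w = (q^{2r})⁻¹·V` (memo (M12): `|y| ≤ |ϖ|^r, |b| ≤ 1`) and `Λ_{w₀} f₁ = (q^{2r′+1})⁻¹·V`
(memo (M21): `|x| ≤ |ϖ|^{r′}, |z| ≤ |ϖ|`), `r + r′ = n`: the split `(r, r′) = (⌊n∕2⌋, ⌈n∕2⌉)` of ★ D174 disappears from the determinant. [cite: Roche1998, §3–§4]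
[cite: Keys1984, §7 Theorem (2) p. 126] -/
theorem volProduct_eq_of_twoDepth (q V Λ1w Λw1 : ℂ) (n r r' : ℕ) (hn : r + r' = n)
    (hw1 : Λw1 = (q ^ (2 * r))⁻¹ * V) (h1w : Λ1w = (q ^ (2 * r' + 1))⁻¹ * V) :
    Λw1 * Λ1w = (q ^ (2 * n + 1))⁻¹ * V ^ 2 := by
  subst hn
  rw [hw1, h1w, show 2 * (r + r') + 1 = 2 * r + (2 * r' + 1) by ring, pow_add, mul_inv]
  ring

/-! ## §2 The closed form of the determinant -/

/-- **THE RESCALING onto the depth-zero letters**: with `V′ := (qⁿ)⁻¹·q·V` (`= q^{1−n}V`), `((q−1)∕q^{n+1})·V = ((q−1)∕q²)·V′` and `(q^{2n+1})⁻¹·V² = V′·((q³)⁻¹·V′)`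
(`q ≠ 0`). [cite: Keys1984, §7 Theorem (2) p. 126] -/
theorem rescale_eq (q V : ℂ) (n : ℕ) (hq : q ≠ 0) :
    (q - 1) / q ^ (n + 1) * V = (q - 1) / q ^ 2 * ((q ^ n)⁻¹ * q * V) ∧
      (q ^ (2 * n + 1))⁻¹ * V ^ 2 = ((q ^ n)⁻¹ * q * V) * ((q ^ 3)⁻¹ * ((q ^ n)⁻¹ * q * V)) := by
  have hqn : q ^ n ≠ 0 := pow_ne_zero n hq
  constructor
  · field_simp
    ring
  · field_simp
    ring

/-- **`det M` IN CLOSED FORM AT POSITIVE DEPTH.**  With `Λ_1 f₁ = c₂·(ε₀·((q−1)∕q^{n+1})·V·X∕(1+X))` (`G₁`), `Λ_{w₀} f_w = −c₂·(ε₀·((q−1)∕q^{n+1})·V∕(1+X))` (`G₂`),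
`Λ_1 f_w · Λ_{w₀} f₁ = (q^{2n+1})⁻¹·V²` (the two volumes), `ε₀² = c₂² = 1`, `q ≠ 0`:
`Λ_1 f₁ · Λ_{w₀} f_w − Λ_1 f_w · Λ_{w₀} f₁ = (q^{1−n}V)² · (−(q−1)²(q⁴)⁻¹·X·((1+X)²)⁻¹ − (q³)⁻¹)` — `q^{2−2n}·V²` times the depth-zero determinant of ★ Z4
`K2E3BranchBDeterminantRoots.det_formula_eq` (memo §4: `det M = G₁G₂ − q^{−2r}·q^{−2r′−1} = q^{2−2n}·(−(q−1)²q⁻⁴X∕(1+X)² − q⁻³)`; `n = 1` is d0B). Proof: ★ Z3-d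
`det_letters_eq` at `V′ = q^{1−n}V`. [cite: Keys1984, §3, §7 Theorem (2) p. 126] [cite: Casselman1980, §3] [cite: Roche1998, §3–§4] -/
theorem det_letters_eq_posDepth (q X ε₀ c₂ V Λ11 Λ1w Λw1 Λww : ℂ) (n : ℕ) (hq : q ≠ 0) (hε : ε₀ ^ 2 = 1) (hc : c₂ ^ 2 = 1)
    (h11 : Λ11 = c₂ * (ε₀ * ((q - 1) / q ^ (n + 1)) * V * X / (1 + X))) (hww : Λww = -(c₂ * (ε₀ * ((q - 1) / q ^ (n + 1)) * V / (1 + X))))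
    (hvol : Λw1 * Λ1w = (q ^ (2 * n + 1))⁻¹ * V ^ 2) :
    Λ11 * Λww - Λw1 * Λ1w = ((q ^ n)⁻¹ * q * V) ^ 2 * (-(q - 1) ^ 2 * (q ^ 4)⁻¹ * X * ((1 + X) ^ 2)⁻¹ - (q ^ 3)⁻¹) := by
  obtain ⟨hk, hv⟩ := rescale_eq q V n hq
  have h11' : Λ11 = c₂ * (ε₀ * ((q - 1) / q ^ 2) * ((q ^ n)⁻¹ * q * V) * X / (1 + X)) := by rw [h11, mul_assoc ε₀, hk, ← mul_assoc]
  have hww' : Λww = -(c₂ * (ε₀ * ((q - 1) / q ^ 2) * ((q ^ n)⁻¹ * q * V) / (1 + X))) := by rw [hww, mul_assoc ε₀, hk, ← mul_assoc]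
  rw [show Λ11 * Λww - Λw1 * Λ1w = Λ11 * Λww - ((q ^ n)⁻¹ * q * V) * ((q ^ 3)⁻¹ * ((q ^ n)⁻¹ * q * V)) by rw [hvol, hv]]
  exact K2E3BranchBDeterminantLettersToRoot.det_letters_eq q X ε₀ c₂ ((q ^ n)⁻¹ * q * V) Λ11 ((q ^ 3)⁻¹ * ((q ^ n)⁻¹ * q * V)) ((q ^ n)⁻¹ * q * V) Λww
    hε hc h11' hww' rfl rfl

/-! ## §3 The admissible root -/

/-- **THE ROOT FROM THE FOUR ENTRIES AT POSITIVE DEPTH.**  For real `q > 1`, `|X| < 1`, `ε₀² = c₂² = 1`, `V ≠ 0`, the big-cell entries `G₁`, `G₂` as in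
`det_letters_eq_posDepth` and the volume product `(q^{2n+1})⁻¹·V²`: `det M = 0` forces **`X = −q⁻¹`** — ★ Z3-d `eq_neg_inv_of_det_eq_zero` at `V′ = q^{1−n}V ≠ 0`
(★ Z4: `det_{d0}(X) = −(qX+1)(X+q)∕(q⁴(1+X)²)`, and the root `X = −q` is excluded by `|X| < 1 < q`).  In the (B-7) assembly: `q = N𝔭_v`, `X = χ₁(ϖ̂)` (`|X| < 1` by
contraction), `V = μ(N₀) > 0`, `ε₀ = λ(δ)`, `c₂ = (−1)^{n+1}`; the output is the `hY` of ★ Z5. [cite: Keys1984, §7 Theorem (2) p. 126] [cite: Casselman1980, §3]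
[cite: Rogawski1990, §12.2 (1)–(2) p. 173] -/
theorem eq_neg_inv_of_det_eq_zero_posDepth (q : ℝ) (hq : 1 < q) (n : ℕ) (X ε₀ c₂ V Λ11 Λ1w Λw1 Λww : ℂ) (hX : ‖X‖ < 1)
    (hε : ε₀ ^ 2 = 1) (hc : c₂ ^ 2 = 1) (hV : V ≠ 0)
    (h11 : Λ11 = c₂ * (ε₀ * (((q : ℂ) - 1) / (q : ℂ) ^ (n + 1)) * V * X / (1 + X)))
    (hww : Λww = -(c₂ * (ε₀ * (((q : ℂ) - 1) / (q : ℂ) ^ (n + 1)) * V / (1 + X))))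
    (hvol : Λw1 * Λ1w = ((q : ℂ) ^ (2 * n + 1))⁻¹ * V ^ 2)
    (hdet : Λ11 * Λww - Λw1 * Λ1w = 0) :
    X = -(q : ℂ)⁻¹ := by
  have hq0 : (q : ℂ) ≠ 0 := by exact_mod_cast (ne_of_gt (lt_trans zero_lt_one hq))
  obtain ⟨hk, hv⟩ := rescale_eq (q : ℂ) V n hq0
  have hV' : ((q : ℂ) ^ n)⁻¹ * (q : ℂ) * V ≠ 0 := mul_ne_zero (mul_ne_zero (inv_ne_zero (pow_ne_zero n hq0)) hq0) hV
  have h11' : Λ11 = c₂ * (ε₀ * (((q : ℂ) - 1) / (q : ℂ) ^ 2) * (((q : ℂ) ^ n)⁻¹ * (q : ℂ) * V) * X / (1 + X)) := by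
    rw [h11, mul_assoc ε₀, hk, ← mul_assoc]
  have hww' : Λww = -(c₂ * (ε₀ * (((q : ℂ) - 1) / (q : ℂ) ^ 2) * (((q : ℂ) ^ n)⁻¹ * (q : ℂ) * V) / (1 + X))) := by
    rw [hww, mul_assoc ε₀, hk, ← mul_assoc]
  have hdet' : Λ11 * Λww - (((q : ℂ) ^ n)⁻¹ * (q : ℂ) * V) * (((q : ℂ) ^ 3)⁻¹ * (((q : ℂ) ^ n)⁻¹ * (q : ℂ) * V)) = 0 := by
    rw [← hv, ← hvol]; exact hdet
  exact K2E3BranchBDeterminantLettersToRoot.eq_neg_inv_of_det_eq_zero q hq X ε₀ c₂ (((q : ℂ) ^ n)⁻¹ * (q : ℂ) * V) Λ11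
    (((q : ℂ) ^ 3)⁻¹ * (((q : ℂ) ^ n)⁻¹ * (q : ℂ) * V)) (((q : ℂ) ^ n)⁻¹ * (q : ℂ) * V) Λww hX hε hc hV' h11' hww' rfl rfl hdet'

/-! ## §4 The end assembly in the CM letters: `det M = 0 ⟹ χ₁ = η·‖·‖^{1∕2}` -/

variable (L : Type) [Field L] [NumberField L] [IsCMField L] (v : HeightOneSpectrum (𝓞 ↥(maximalRealSubfield L)))

/-- **THE END ASSEMBLY FROM `det M = 0` AT POSITIVE DEPTH, FRAME-FREE** (the twin of ★ FromDet §1 `exists_eta_of_det_eq_zero_of_pairEntries` with the entries at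
conductor `n`).  `v` non-split and UNRAMIFIED in `L` (inert); `χ₁` continuous with `χ₁(u·σu) = 1` on the units of valuation one (Branch B); letters `V ≠ 0`, `ε₀² = 1`,
`c₂² = 1`; `X = χ₁(ϖ̂)` with `|X| < 1`, `q = N𝔭_v`; four complex numbers `Λ11 = c₂·(ε₀·((q−1)∕q^{n+1})·V·X∕(1+X))` (`G₁`, (B-5′)), `Λww = −c₂·(ε₀·((q−1)∕q^{n+1})·V∕(1+X))`
(`G₂`, (B-5)), `Λw1·Λ1w = (q^{2n+1})⁻¹·V²` (the two volumes) with `Λ11·Λww − Λw1·Λ1w = 0` ((B-0) ★ `R90S1BranchBDeterminantVanishingCells`).  Then **`χ₁ = η·‖·‖^{1∕2}`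
for a continuous quadratic character extension `η`** — DISJUNCT 2 of U4Keys :182: §3 gives `X = −1∕q` (`1 < q` ★ `NumberField.HeightOneSpectrum.one_lt_absNorm`), ★ Z5
`exists_eta_of_branchB_of_apply_uniformizer_eq_neg_inv_absNorm` (no depth hypothesis among its binders) converts. [cite: Keys1984, §3, §7 Theorem (2) p. 126]
[cite: Casselman1980, §3] [cite: Rogawski1990, §12.2 (1)–(2) p. 173] -/
theorem exists_eta_of_det_eq_zero_of_pairEntries_posDepth
    (hns : ∀ w' : PlacesOver L v, IsCMField.complexConj L • w'.1 = w'.1) (hunr : Algebra.IsUnramifiedIn (𝓞 L) v.asIdeal)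
    (χ₁ : (LocalRing L v)ˣ →* ℂˣ) (h₁ : Continuous fun x => ((χ₁ x : ℂˣ) : ℂ))
    (hB : ∀ u : (LocalRing L v)ˣ, (∀ w' : PlacesOver L v, Valued.v ((u : LocalRing L v) w') = 1) →
      χ₁ (u * Units.map (conjLocal L (IsCMField.complexConj L) v : LocalRing L v →* LocalRing L v) u) = 1)
    (n : ℕ) (V ε₀ c₂ Λ11 Λ1w Λw1 Λww : ℂ) (hV : V ≠ 0) (hε : ε₀ ^ 2 = 1) (hc : c₂ ^ 2 = 1)
    (hY : ‖((χ₁ (isUnit_toLocalRing_uniformizer L v).unit : ℂˣ) : ℂ)‖ < 1)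
    (h11v : Λ11 = c₂ * (ε₀ * ((((Ideal.absNorm v.asIdeal : ℝ) : ℂ) - 1) / ((Ideal.absNorm v.asIdeal : ℝ) : ℂ) ^ (n + 1)) * V *
      ((χ₁ (isUnit_toLocalRing_uniformizer L v).unit : ℂˣ) : ℂ) / (1 + ((χ₁ (isUnit_toLocalRing_uniformizer L v).unit : ℂˣ) : ℂ))))
    (hwwv : Λww = -(c₂ * (ε₀ * ((((Ideal.absNorm v.asIdeal : ℝ) : ℂ) - 1) / ((Ideal.absNorm v.asIdeal : ℝ) : ℂ) ^ (n + 1)) * V /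
      (1 + ((χ₁ (isUnit_toLocalRing_uniformizer L v).unit : ℂˣ) : ℂ)))))
    (hvol : Λw1 * Λ1w = (((Ideal.absNorm v.asIdeal : ℝ) : ℂ) ^ (2 * n + 1))⁻¹ * V ^ 2)
    (hdet : Λ11 * Λww - Λw1 * Λ1w = 0) :
    ∃ η : (LocalRing L v)ˣ →* ℂˣ, IsQuadraticCharExtension (conjLocal L (IsCMField.complexConj L) v) η ∧
      Continuous (fun x => ((η x : ℂˣ) : ℂ)) ∧ χ₁ = η * halfModulusChar (LocalRing L v) := by
  have hq : (1 : ℝ) < (Ideal.absNorm v.asIdeal : ℝ) := by exact_mod_cast NumberField.HeightOneSpectrum.one_lt_absNorm v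
  have hroot := eq_neg_inv_of_det_eq_zero_posDepth (Ideal.absNorm v.asIdeal : ℝ) hq n ((χ₁ (isUnit_toLocalRing_uniformizer L v).unit : ℂˣ) : ℂ) ε₀ c₂ V
    Λ11 Λ1w Λw1 Λww hY hε hc hV h11v hwwv hvol hdet
  rw [Complex.ofReal_natCast] at hroot
  exact K2E3KeysThmTwoDepthZeroBranchBConversion.exists_eta_of_branchB_of_apply_uniformizer_eq_neg_inv_absNorm L v hns hunr χ₁ h₁ hB hroot

/-- **THE END ASSEMBLY FROM `det M = 0` AT POSITIVE DEPTH, WITH THE TWO VOLUMES SPLIT BY THE DEPTHS `r + r′ = n`** (the shape the leaf (B-7) feeds: `Λ_1 f_w =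
(q^{2r})⁻¹·V` = `vol(N ∩ J_e)`, `Λ_{w₀} f₁ = (q^{2r′+1})⁻¹·V` = `vol{n : w₀ n w₀ ∈ P·J_e}`, `e = (r, 0; r′, 1)`, `(r, r′) = (⌊n∕2⌋, ⌈n∕2⌉)`): §1 + the frame-free theorem
above. [cite: Keys1984, §3, §7 Theorem (2) p. 126] [cite: Roche1998, §3–§4] [cite: Rogawski1990, §12.2 (1)–(2) p. 173] -/
theorem exists_eta_of_det_eq_zero_of_pairEntries_twoDepth
    (hns : ∀ w' : PlacesOver L v, IsCMField.complexConj L • w'.1 = w'.1) (hunr : Algebra.IsUnramifiedIn (𝓞 L) v.asIdeal)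
    (χ₁ : (LocalRing L v)ˣ →* ℂˣ) (h₁ : Continuous fun x => ((χ₁ x : ℂˣ) : ℂ))
    (hB : ∀ u : (LocalRing L v)ˣ, (∀ w' : PlacesOver L v, Valued.v ((u : LocalRing L v) w') = 1) →
      χ₁ (u * Units.map (conjLocal L (IsCMField.complexConj L) v : LocalRing L v →* LocalRing L v) u) = 1)
    (n r r' : ℕ) (hn : r + r' = n) (V ε₀ c₂ Λ11 Λ1w Λw1 Λww : ℂ) (hV : V ≠ 0) (hε : ε₀ ^ 2 = 1) (hc : c₂ ^ 2 = 1)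
    (hY : ‖((χ₁ (isUnit_toLocalRing_uniformizer L v).unit : ℂˣ) : ℂ)‖ < 1)
    (h11v : Λ11 = c₂ * (ε₀ * ((((Ideal.absNorm v.asIdeal : ℝ) : ℂ) - 1) / ((Ideal.absNorm v.asIdeal : ℝ) : ℂ) ^ (n + 1)) * V *
      ((χ₁ (isUnit_toLocalRing_uniformizer L v).unit : ℂˣ) : ℂ) / (1 + ((χ₁ (isUnit_toLocalRing_uniformizer L v).unit : ℂˣ) : ℂ))))
    (hwwv : Λww = -(c₂ * (ε₀ * ((((Ideal.absNorm v.asIdeal : ℝ) : ℂ) - 1) / ((Ideal.absNorm v.asIdeal : ℝ) : ℂ) ^ (n + 1)) * V /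
      (1 + ((χ₁ (isUnit_toLocalRing_uniformizer L v).unit : ℂˣ) : ℂ)))))
    (hw1v : Λw1 = (((Ideal.absNorm v.asIdeal : ℝ) : ℂ) ^ (2 * r))⁻¹ * V) (h1wv : Λ1w = (((Ideal.absNorm v.asIdeal : ℝ) : ℂ) ^ (2 * r' + 1))⁻¹ * V)
    (hdet : Λ11 * Λww - Λw1 * Λ1w = 0) :
    ∃ η : (LocalRing L v)ˣ →* ℂˣ, IsQuadraticCharExtension (conjLocal L (IsCMField.complexConj L) v) η ∧
      Continuous (fun x => ((η x : ℂˣ) : ℂ)) ∧ χ₁ = η * halfModulusChar (LocalRing L v) :=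
  exists_eta_of_det_eq_zero_of_pairEntries_posDepth L v hns hunr χ₁ h₁ hB n V ε₀ c₂ Λ11 Λ1w Λw1 Λww hV hε hc hY h11v hwwv
    (volProduct_eq_of_twoDepth ((Ideal.absNorm v.asIdeal : ℝ) : ℂ) V Λ1w Λw1 n r r' hn hw1v h1wv) hdet

end Summit.HodgeConjecture.HodgeConjecture.R90.S1.BposDeterminantClosedForm

end
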